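import Summits.BirchSwinnertonDyer.Rank1Residual.X11b.KolyvaginFrobeniusEigenlines
import Literature.NumberTheory.EllipticCurves.BSDQuadraticDescentTorsionOddPartProofs
import Literature.NumberTheory.EllipticCurves.SupersingularDensityDeuringCriterionProofs
import Literature.NumberTheory.EllipticCurves.IwasawaSelmerControlAwayFromPProofs
import Mathlib.GroupTheory.SpecificGroups.Cyclic
import HarnessLib

/-!
# The `±`-eigen `p`-parts of `Ẽ(𝔽_{ℓ²})` under `Frob_ℓ` are cyclic of order exactly `p^{v_p(ℓ+1∓a_ℓ)}`

Cell `b2b-bsdres`, team x11b3 (N8/O2), sub-target S15 (viii) (lead ruling R7-62), continuing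
`KolyvaginFrobeniusEigenlines`. HONEST FRAMING (cell, verbatim): published theorems only; nothing
here is `p = 3`-specific; Kolyvagin-chain hygiene, not a discharge of `h44`; nothing booked.
Theorems only — no definition, no named fact.

This file proves the three finite-field conjuncts `htors`, `hchar`, `hcyc` of the abstract
**reduction datum** of the tree's
`Literature.NumberTheory.EllipticCurves.zsmul_kolyvaginClass_mem_selmerLocalKer_iff_mem_torsionLocalKer`
(`HeegnerPointsKolyvaginPrimaryRamifiedProofs`, §4: McCallum 1991 Prop. 4.4 / Gross 1991 Prop. 6.2
(2) in order form) for `B = Ẽ(𝔽̄_ℓ)`, `φ = Frob_ℓ`: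

* `exists_generator_of_natCard_torsionBy_le` — a finite abelian `p`-group whose `p`-torsion has
  at most `p` elements is cyclic (elementary: `#G[p^{j+1}] ≤ #G[p^j] · #G[p]`).
* `exists_eigen_generator` — the `s`-eigen `p`-part of `Ẽ(𝔽̄_ℓ)` is cyclic of order exactly
  `p^{v_p(#{Frob = s})}` (its `p`-torsion sits in the eigenline `Ẽ[p]^{Frob = s}` of order `p`;
  tree `natCard_primaryComponent_eq_pow_padicValNat`).
* `exists_eigenSubgroup_card` — `#{Frob = s} = ℓ + 1 - s·a`, `a = ℓ + 1 - #Ẽ(𝔽_ℓ)` (Gross (3.4);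
  `ℓ` odd by the twist count of `KolyvaginFrobeniusEigenlines`, `ℓ = 2` directly: then `p = 3`,
  `a = 0`, and the anti-fixed points are `3`-torsion).
* **`frobenius_eigen_datum`** — the package: every point of `Ẽ(𝔽̄_ℓ)` is torsion;
  `(ℓ + 1) b = a · Frob b` on `{Frob² = 1}` (Manin / AEC V.2.3.1, tree
  `frobenius_frobenius_sub_trace_smul_add_card_smul`; McCallum: *"Since `Frob(l)² = 1` on `F_λ`,
  `(a_l - (l+1)Frob(l))P̃ = 0`"*); and for `s = ±1` a generator of the `s`-eigen `p`-part of order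
  exactly `p^{v_p(ℓ + 1 - s a)}` (McCallum, proof of Prop. 4.4 (2): *"the `Gal(K/ℚ)`-eigenspaces of
  `E(F_λ)` are cyclic of order `l + 1 - Frob(l) a_l`"*). Hypotheses: `p` odd, `p ≠ ℓ`, `p ∣ ℓ + 1`,
  `p ∣ a` (Gross (3.3)), and `Frob_ℓ` acts on `Ẽ[p]` as a non-scalar involution (Gross (3.2)
  transported by reduction — supplied by `KolyvaginReductionDatum`).

## References
* [McCallumLMS1991] W. G. McCallum, *Kolyvagin's work on Shafarevich–Tate groups*, LMS LNS 153
  (1991), Prop. 4.4 and its proof (held `book:editornd-l-functions-arithmetic`, PDF pp. 282–283).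
* [GrossLMS1991] B. H. Gross, *Kolyvagin's work on modular elliptic curves*, ibid., §3 (3.2)–(3.4)
  (PDF p. 216), Prop. 6.2 (2) (PDF pp. 222–223).
* [SilvermanAEC2009] J. H. Silverman, *The Arithmetic of Elliptic Curves*, 2nd ed., V.2.3.1,
  Exercise 10.16.
-/

noncomputable section

open scoped Classical
open WeierstrassCurve Field
open Literature.NumberTheory.EllipticCurves

namespace Summit.BirchSwinnertonDyer.Rank1Residual.X11b.KolyvaginH44

/-! ## Finite abelian `p`-groups with a cyclic `p`-torsion are cyclic -/

section Cyclic

variable {G : Type*} [AddCommGroup G] [Finite G] {p : ℕ} [hp : Fact p.Prime]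

omit hp in
/-- `#G[p^(j+1)] ≤ #G[p^j] · #G[p]`: multiplication by `p` maps `G[p^(j+1)]` to `G[p^j]` with
kernel inside `G[p]`. [folklore] -/
theorem natCard_torsionBy_pow_succ_le (j : ℕ) :
    Nat.card (AddSubgroup.torsionBy G ((p : ℤ) ^ (j + 1))) ≤
      Nat.card (AddSubgroup.torsionBy G ((p : ℤ) ^ j)) * Nat.card (AddSubgroup.torsionBy G (p : ℤ)) := by
  set H := AddSubgroup.torsionBy G ((p : ℤ) ^ (j + 1)) with hH
  have hmem : ∀ {n : ℤ} {x : G}, x ∈ AddSubgroup.torsionBy G n ↔ n • x = 0 := by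
    intro n x
    rw [AddSubgroup.torsionBy, Submodule.mem_toAddSubgroup, Submodule.mem_torsionBy_iff]
  -- multiplication by `p` on `H`
  set f : H →+ G := (zsmulAddGroupHom (p : ℤ) : G →+ G).comp H.subtype with hf
  have hf_apply : ∀ x : H, f x = (p : ℤ) • (x : G) := fun x ↦ rfl
  have hrange : f.range ≤ AddSubgroup.torsionBy G ((p : ℤ) ^ j) := by
    rintro _ ⟨x, rfl⟩
    rw [hmem, hf_apply, smul_smul, ← pow_succ, ← hmem]
    exact x.2
  have hker : Function.Injective (fun x : f.ker ↦ (⟨(x : H), by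
      rw [hmem]
      have := x.2
      rwa [AddMonoidHom.mem_ker, hf_apply] at this⟩ : AddSubgroup.torsionBy G (p : ℤ))) := by
    intro x y h
    apply Subtype.ext; apply Subtype.ext
    have h' := congrArg (fun z : AddSubgroup.torsionBy G (p : ℤ) ↦ (z : G)) h
    simpa using h'
  calc Nat.card H = Nat.card (H ⧸ f.ker) * Nat.card f.ker :=
        AddSubgroup.card_eq_card_quotient_mul_card_addSubgroup _
    _ = Nat.card f.range * Nat.card f.ker := by
        rw [Nat.card_congr (QuotientAddGroup.quotientKerEquivRange f).toEquiv]
    _ ≤ Nat.card (AddSubgroup.torsionBy G ((p : ℤ) ^ j)) *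
          Nat.card (AddSubgroup.torsionBy G (p : ℤ)) :=
        Nat.mul_le_mul (AddSubgroup.card_le_of_le hrange) (Nat.card_le_card_of_injective _ hker)

omit hp in
/-- `#G[p^j] ≤ p^j` when `#G[p] ≤ p`. [folklore] -/
theorem natCard_torsionBy_pow_le (h1 : Nat.card (AddSubgroup.torsionBy G (p : ℤ)) ≤ p) (j : ℕ) :
    Nat.card (AddSubgroup.torsionBy G ((p : ℤ) ^ j)) ≤ p ^ j := by
  induction j with
  | zero =>
    rw [pow_zero, pow_zero]
    have : AddSubgroup.torsionBy G (1 : ℤ) = ⊥ := by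
      ext x
      rw [AddSubgroup.torsionBy, Submodule.mem_toAddSubgroup, Submodule.mem_torsionBy_iff, one_smul,
        AddSubgroup.mem_bot]
    rw [this, AddSubgroup.card_bot]
  | succ j ih =>
    calc _ ≤ _ := natCard_torsionBy_pow_succ_le j
      _ ≤ p ^ j * p := Nat.mul_le_mul ih h1
      _ = p ^ (j + 1) := (pow_succ p j).symm

/-- **A finite abelian `p`-group whose `p`-torsion has at most `p` elements is cyclic**, generated
by any element of maximal order; that order is `#G`. [folklore] -/
theorem exists_generator_of_natCard_torsionBy_le (hG : ∀ g : G, ∃ n : ℕ, p ^ n • g = 0)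
    (h1 : Nat.card (AddSubgroup.torsionBy G (p : ℤ)) ≤ p) :
    ∃ g : G, addOrderOf g = Nat.card G ∧ (∃ m : ℕ, Nat.card G = p ^ m) ∧
      ∀ c : G, ∃ i : ℤ, c = i • g := by
  obtain ⟨g, hg⟩ := AddMonoid.exists_addOrderOf_eq_exponent (G := G) AddMonoid.ExponentExists.of_finite
  -- the exponent is a power of `p`
  obtain ⟨n, hn⟩ := hG g
  have hdvd : addOrderOf g ∣ p ^ n := addOrderOf_dvd_of_nsmul_eq_zero hn
  obtain ⟨m, -, hm⟩ := (Nat.dvd_prime_pow hp.out).mp hdvd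
  -- `G = G[p^m]`, so `#G ≤ p^m = #⟨g⟩`
  have hall : ∀ c : G, ((p : ℤ) ^ m) • c = 0 := fun c ↦ by
    rw [← Nat.cast_pow, natCast_zsmul, ← hm, hg]
    exact AddMonoid.exponent_nsmul_eq_zero c
  have htop : AddSubgroup.torsionBy G ((p : ℤ) ^ m) = ⊤ := by
    ext c
    rw [AddSubgroup.torsionBy, Submodule.mem_toAddSubgroup, Submodule.mem_torsionBy_iff]
    exact ⟨fun _ ↦ AddSubgroup.mem_top c, fun _ ↦ hall c⟩
  have hle : Nat.card G ≤ p ^ m := by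
    have := natCard_torsionBy_pow_le h1 m
    rwa [htop, AddSubgroup.card_top] at this
  have hzm : Nat.card (AddSubgroup.zmultiples g) = p ^ m := by rw [Nat.card_zmultiples, hm]
  have hge : p ^ m ≤ Nat.card G := by
    rw [← hzm]; exact AddSubgroup.card_le_card_addGroup _
  have hcardG : Nat.card G = p ^ m := le_antisymm hle hge
  have hztop : AddSubgroup.zmultiples g = ⊤ :=
    AddSubgroup.eq_top_of_card_eq _ (by rw [hzm, hcardG])
  refine ⟨g, by rw [hm, hcardG], ⟨m, hcardG⟩, fun c ↦ ?_⟩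
  have hc : c ∈ AddSubgroup.zmultiples g := by rw [hztop]; exact AddSubgroup.mem_top c
  obtain ⟨i, hi⟩ := AddSubgroup.mem_zmultiples_iff.mp hc
  exact ⟨i, hi.symm⟩

end Cyclic

/-! ## Cyclic eigen-`p`-parts of exact order (McCallum 1991, proof of Prop. 4.4 (2)) -/

section Assembly

variable {k : Type*} [Field k] (E : WeierstrassCurve k) {σ : absoluteGaloisGroup k}
  {p : ℕ} [hp : Fact p.Prime]

/-- **The `s`-eigen `p`-part is cyclic of order exactly `p^{v_p(N)}`**, `N = #{P : σP = sP}`: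
it is the `p`-primary component of the finite eigen-subgroup `A` (order `p^{v_p(#A)}`, tree
`natCard_primaryComponent_eq_pow_padicValNat`), and its `p`-torsion sits in the eigenline
`Ẽ[p]^{σ = s}` of order `≤ p`, so it is cyclic (`exists_generator_of_natCard_torsionBy_le`).
McCallum 1991, proof of Prop. 4.4: *"the `Gal(K/ℚ)`-eigenspaces of `E(F_λ)` are cyclic of order
`l + 1 - Frob(l) a_l`"*. [cite: McCallumLMS1991, Prop. 4.4 (proof)] -/
theorem exists_eigen_generator {s : ℤ} (A : AddSubgroup (geomPoints E))
    (hA : ∀ P, P ∈ A ↔ σ • P = s • P) [Finite A]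
    [Finite {P : geomPoints E // (p : ℤ) • P = 0 ∧ σ • P = s • P}]
    (h1 : Nat.card {P : geomPoints E // (p : ℤ) • P = 0 ∧ σ • P = s • P} ≤ p)
    {N : ℤ} (hN : (Nat.card A : ℤ) = N) :
    ∃ (g : geomPoints E) (e : ℕ), σ • g = s • g ∧ addOrderOf g = p ^ e ∧ (p : ℤ) ^ e ∣ N ∧
      ¬ (p : ℤ) ^ (e + 1) ∣ N ∧
      ∀ c : geomPoints E, σ • c = s • c → (∃ k : ℕ, ((p : ℤ) ^ k) • c = 0) → ∃ i : ℤ, c = i • g := by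
  set C := AddCommGroup.primaryComponent A p with hC
  have hCcard : Nat.card C = p ^ padicValNat p (Nat.card A) :=
    natCard_primaryComponent_eq_pow_padicValNat p
  -- `C` is a `p`-group
  have hCp : ∀ g : C, ∃ n : ℕ, p ^ n • g = 0 := fun g ↦ by
    obtain ⟨n, hn⟩ := AddCommGroup.mem_primaryComponent.mp g.2
    exact ⟨n, Subtype.ext hn⟩
  -- `#C[p] ≤ p`: `C[p]` injects into the eigenline
  have hmem : ∀ {x : C}, x ∈ AddSubgroup.torsionBy C (p : ℤ) ↔ (p : ℤ) • x = 0 := fun {x} ↦ by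
    rw [AddSubgroup.torsionBy, Submodule.mem_toAddSubgroup, Submodule.mem_torsionBy_iff]
  have hC1 : Nat.card (AddSubgroup.torsionBy C (p : ℤ)) ≤ p := by
    refine le_trans (Nat.card_le_card_of_injective (fun x : AddSubgroup.torsionBy C (p : ℤ) ↦
      (⟨(((x : C) : A) : geomPoints E), ?_, (hA _).mp ((x : C) : A).2⟩ :
        {P : geomPoints E // (p : ℤ) • P = 0 ∧ σ • P = s • P})) ?_) h1
    · have hx := hmem.mp x.2
      have h1 : (((((p : ℤ) • (x : C) : C) : A) : geomPoints E)) =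
          (p : ℤ) • (((x : C) : A) : geomPoints E) := by
        simp only [AddSubgroupClass.coe_zsmul]
      rw [← h1, hx]; rfl
    · intro x y h
      apply Subtype.ext; apply Subtype.ext; apply Subtype.ext
      have h' := congrArg (fun z : {P : geomPoints E // (p : ℤ) • P = 0 ∧ σ • P = s • P} ↦
        (z : geomPoints E)) h
      simpa using h'
  obtain ⟨g₀, hg₀, ⟨m, hm⟩, hgen⟩ := exists_generator_of_natCard_torsionBy_le hCp hC1
  have hme : m = padicValNat p (Nat.card A) :=
    Nat.pow_right_injective hp.out.two_le (hm.symm.trans hCcard)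
  have hA0 : Nat.card A ≠ 0 := Nat.card_pos.ne'
  refine ⟨((g₀ : A) : geomPoints E), m, (hA _).mp (g₀ : A).2, ?_, ?_, ?_, ?_⟩
  · rw [AddSubgroup.addOrderOf_coe, AddSubgroup.addOrderOf_coe, hg₀, hm]
  · rw [← hN, hme]
    exact_mod_cast (pow_padicValNat_dvd : p ^ padicValNat p (Nat.card A) ∣ Nat.card A)
  · rw [← hN, hme]
    have h := pow_succ_padicValNat_not_dvd (p := p) hA0
    intro h'
    exact h (by exact_mod_cast h')
  · rintro c hc ⟨j, hj⟩
    have hcA : c ∈ A := (hA c).mpr hc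
    have hcC : (⟨c, hcA⟩ : A) ∈ C := by
      rw [hC, AddCommGroup.mem_primaryComponent]
      refine ⟨j, Subtype.ext ?_⟩
      rw [AddSubgroupClass.coe_nsmul, AddSubgroup.coe_zero, ← natCast_zsmul, Nat.cast_pow]
      exact hj
    obtain ⟨i, hi⟩ := hgen ⟨⟨c, hcA⟩, hcC⟩
    refine ⟨i, ?_⟩
    have := congrArg (fun z : C ↦ ((z : A) : geomPoints E)) hi
    simpa using this

end Assembly

/-! ## The finite-field half of the reduction datum at a Kolyvagin prime -/

section Datum

variable {ℓ : ℕ} [hℓ : Fact ℓ.Prime] (E : WeierstrassCurve (ZMod ℓ)) [E.IsElliptic]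
  {σ : absoluteGaloisGroup (ZMod ℓ)} (hσ : ∀ x : AlgebraicClosure (ZMod ℓ), σ • x = x ^ ℓ)
  {p : ℕ} [hp : Fact p.Prime]

include hσ in
/-- Frobenius on `𝔽̄_ℓ` in the `Nat.card` normalisation of the tree's finite-field files.
[folklore] -/
theorem frob_pow_card : ∀ x : AlgebraicClosure (ZMod ℓ), σ • x = x ^ Nat.card (ZMod ℓ) := by
  intro x; rw [Nat.card_zmod]; exact hσ x

omit [E.IsElliptic] hp in
/-- The `s`-eigen subgroup `{P : σP = sP}` of `Ẽ(𝔽̄_ℓ)` (kernel of `σ - s`). [folklore] -/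
theorem exists_eigenSubgroup (s : ℤ) :
    ∃ A : AddSubgroup (geomPoints E), ∀ P, P ∈ A ↔ σ • P = s • P :=
  ⟨(DistribSMul.toAddMonoidHom (geomPoints E) σ - DistribSMul.toAddMonoidHom (geomPoints E) s).ker,
    fun P ↦ by rw [AddMonoidHom.mem_ker, AddMonoidHom.sub_apply, sub_eq_zero]; rfl⟩

omit [E.IsElliptic] hp in
/-- **Every point of `Ẽ(𝔽̄_ℓ)` is torsion**: its coordinates lie in a finite field (tree
`isOfFinAddOrder_point_of_isAlgebraic`). [folklore] -/
theorem isOfFinAddOrder_geomPoints (P : geomPoints E) : IsOfFinAddOrder P :=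
  isOfFinAddOrder_point_of_isAlgebraic E P

include hσ in
/-- **Manin's relation on `{Frob² = 1}`**: `(ℓ + 1) b = a · Frob b` with `a = ℓ + 1 - #Ẽ(𝔽_ℓ)`
(tree `frobenius_frobenius_sub_trace_smul_add_card_smul`, Silverman AEC V.2.3.1; McCallum 1991,
proof of Prop. 4.4: *"Since `Frob(l)² = 1` on `F_λ`, `(a_l - (l+1) Frob(l)) P̃ = 0`"*).
[cite: McCallumLMS1991, Prop. 4.4 (proof)] [cite: SilvermanAEC2009, Thm. V.2.3.1(b)] -/
theorem add_one_smul_eq_trace_smul_frob {a : ℤ} (ha : a = (ℓ : ℤ) + 1 - Nat.card E.toAffine.Point)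
    (b : geomPoints E) (hb : σ • σ • b = b) : ((ℓ + 1 : ℕ) : ℤ) • b = a • σ • b := by
  have h := E.frobenius_frobenius_sub_trace_smul_add_card_smul (frob_pow_card hσ) b
  rw [Nat.card_zmod, hb, ← ha] at h
  set y := σ • b with hy
  push_cast at h ⊢
  rw [add_smul, one_smul, ← sub_eq_zero, ← h]
  abel

/-- `(p : ZMod ℓ) ≠ 0` for distinct primes. [folklore] -/
theorem natCast_ne_zero_of_ne (hpℓ : p ≠ ℓ) : (p : ZMod ℓ) ≠ 0 := by
  rw [ne_eq, ZMod.natCast_eq_zero_iff]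
  intro h
  exact hpℓ ((Nat.prime_dvd_prime_iff_eq hℓ.out hp.out).mp h).symm

end Datum

section Main

variable {ℓ : ℕ} [hℓ : Fact ℓ.Prime] (E : WeierstrassCurve (ZMod ℓ)) [E.IsElliptic]
  {σ : absoluteGaloisGroup (ZMod ℓ)} (hσ : ∀ x : AlgebraicClosure (ZMod ℓ), σ • x = x ^ ℓ)
  {p : ℕ} [hp : Fact p.Prime]

include hσ in
/-- **The eigen-subgroups `{Frob = ±1}` of `Ẽ(𝔽̄_ℓ)` are finite of orders `ℓ + 1 ∓ a`**
(`a = ℓ + 1 - #Ẽ(𝔽_ℓ)`; Gross 1991 (3.4): *"`Ẽ(F_λ)^+` has order `ℓ+1-a_ℓ`, and `Ẽ(F_λ)^-` has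
order `ℓ+1+a_ℓ`"*). Plus: the `𝔽_ℓ`-points. Minus, `ℓ` odd: the twist count (Knapp 12.10);
`ℓ = 2`: then `p = 3`, `a = 0` and every anti-fixed point is `3`-torsion, so the count is the
eigenline count `3`. [cite: GrossLMS1991, §3 (3.4)] -/
theorem exists_eigenSubgroup_card (hp2 : p ≠ 2) (hpℓ : p ≠ ℓ)
    {a : ℤ} (ha : a = (ℓ : ℤ) + 1 - Nat.card E.toAffine.Point)
    (hpl : p ∣ ℓ + 1) (hpa : (p : ℤ) ∣ a)
    (hinv : ∀ P : geomPoints E, (p : ℤ) • P = 0 → σ • σ • P = P)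
    (hns : ∀ s : ℤ, s = 1 ∨ s = -1 → ¬ ∀ P : geomPoints E, (p : ℤ) • P = 0 → σ • P = s • P)
    {s : ℤ} (hs : s = 1 ∨ s = -1) :
    ∃ A : AddSubgroup (geomPoints E), (∀ P, P ∈ A ↔ σ • P = s • P) ∧ Finite A ∧
      (Nat.card A : ℤ) = ((ℓ + 1 : ℕ) : ℤ) - s * a := by
  obtain ⟨A, hA⟩ := exists_eigenSubgroup E (σ := σ) s
  have hcardA : Nat.card A = Nat.card {P : geomPoints E // σ • P = s • P} :=
    Nat.card_congr (Equiv.subtypeEquivRight hA)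
  haveI : Finite E.toAffine.Point := finite_point E
  rcases hs with rfl | rfl
  · -- plus part = `𝔽_ℓ`-points
    have h1 : Nat.card A = Nat.card E.toAffine.Point := by
      rw [hcardA, ← natCard_smul_eq_self E (frob_pow_card hσ)]
      exact Nat.card_congr (Equiv.subtypeEquivRight fun P ↦ by rw [one_smul])
    refine ⟨A, hA, Nat.finite_of_card_ne_zero (by rw [h1]; exact Nat.card_pos.ne'), ?_⟩
    rw [h1, ha]; push_cast; ring
  · -- minus part
    have hm : Nat.card A = Nat.card {P : geomPoints E // σ • P = -P} := by
      rw [hcardA]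
      exact Nat.card_congr (Equiv.subtypeEquivRight fun P ↦ by rw [neg_one_zsmul])
    by_cases hℓ2 : ℓ = 2
    · -- `ℓ = 2`: `p = 3`, `a = 0`, anti-fixed points are `3`-torsion
      subst hℓ2
      have hp3 : p = 3 := (Nat.prime_dvd_prime_iff_eq hp.out Nat.prime_three).mp hpl
      subst hp3
      have hle : Nat.card E.toAffine.Point ≤ 2 * Fintype.card (ZMod 2) + 1 :=
        natCard_point_le_two_mul_card_add_one E
      have hge : 1 ≤ Nat.card E.toAffine.Point := one_le_natCard_point E
      rw [ZMod.card] at hle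
      have ha0 : a = 0 := by
        obtain ⟨t, ht⟩ := hpa
        omega
      have h3 : ∀ P : geomPoints E, σ • P = -P → ((3 : ℕ) : ℤ) • P = 0 := fun P hP ↦ by
        have hPP : σ • σ • P = P := by rw [hP, smul_neg, hP, neg_neg]
        have := add_one_smul_eq_trace_smul_frob E hσ ha P hPP
        rw [ha0, zero_smul] at this
        exact_mod_cast this
      have h32 : ((3 : ℕ) : ZMod 2) ≠ 0 := natCast_ne_zero_of_ne (ℓ := 2) (p := 3) (by decide)
      have hcard3 := natCard_torsion_eigen E (σ := σ) (by decide) h32 hinv hns (s := -1) (Or.inr rfl)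
      have e : {P : geomPoints E // σ • P = -P} ≃
          {P : geomPoints E // ((3 : ℕ) : ℤ) • P = 0 ∧ σ • P = (-1 : ℤ) • P} :=
        { toFun := fun P ↦ ⟨P.1, h3 P.1 P.2, by have h := P.2; rwa [← neg_one_zsmul] at h⟩
          invFun := fun P ↦ ⟨P.1, by have h := P.2.2; rwa [neg_one_zsmul] at h⟩
          left_inv := fun P ↦ rfl
          right_inv := fun P ↦ rfl }
      have hA3 : Nat.card A = 3 := by rw [hm, Nat.card_congr e, hcard3]
      refine ⟨A, hA, Nat.finite_of_card_ne_zero (by rw [hA3]; decide), ?_⟩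
      rw [hA3, ha0]; norm_num
    · -- `ℓ` odd: the twist count
      haveI : NeZero (2 : ZMod ℓ) :=
        ⟨by exact_mod_cast natCast_ne_zero_of_ne (ℓ := ℓ) (p := 2) (Ne.symm hℓ2)⟩
      have hcount := natCard_smul_eq_neg_eq E (frob_pow_card hσ)
      rw [Nat.card_zmod, ← hm] at hcount
      refine ⟨A, hA, Nat.finite_of_card_ne_zero ?_, ?_⟩
      · intro h0
        rw [h0, ← ha] at hcount
        haveI : Finite E.toAffine.Point := finite_point E
        have hle : (Nat.card E.toAffine.Point : ℤ) ≤ 2 * ℓ + 1 := by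
          haveI : Fintype (ZMod ℓ) := ZMod.fintype ℓ
          have := natCard_point_le_two_mul_card_add_one E
          rw [ZMod.card] at this
          exact_mod_cast this
        rw [ha] at hcount
        push_cast at hcount
        linarith
      · rw [hcount, ← ha]; push_cast; ring

include hσ in
/-- **The finite-field half of McCallum's reduction datum at a Kolyvagin prime** — the conjuncts
`htors`, `hchar`, `hcyc` of the tree's
`zsmul_kolyvaginClass_mem_selmerLocalKer_iff_mem_torsionLocalKer`
(`HeegnerPointsKolyvaginPrimaryRamifiedProofs`, §4) for `B = Ẽ(𝔽̄_ℓ)`, `φ = Frob_ℓ`: every point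
of `Ẽ(𝔽̄_ℓ)` is torsion; `(ℓ + 1) b = a · Frob b` on `{Frob² = 1} = Ẽ(𝔽_{ℓ²})`; and for `s = ±1`
the `s`-eigen `p`-part is cyclic of order exactly `p^{v_p(ℓ + 1 - s a)}` (McCallum 1991, proof of
Prop. 4.4 (2): *"the `Gal(K/ℚ)`-eigenspaces of `E(F_λ)` are cyclic of order `l+1-Frob(l)a_l`"*;
Gross 1991 (3.4)). Hypotheses: `p` odd, `p ≠ ℓ`, `p ∣ ℓ + 1`, `p ∣ a` (Gross (3.3)), and Frobenius
acts on `Ẽ[p]` as a non-scalar involution (Gross (3.2): `Frob(ℓ) = Frob(∞)` on `E_p`, transported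
by reduction). [cite: McCallumLMS1991, Prop. 4.4 (proof)] [cite: GrossLMS1991, §3 (3.2)–(3.4)] -/
theorem frobenius_eigen_datum (hp2 : p ≠ 2) (hpℓ : p ≠ ℓ)
    {a : ℤ} (ha : a = (ℓ : ℤ) + 1 - Nat.card E.toAffine.Point)
    (hpl : p ∣ ℓ + 1) (hpa : (p : ℤ) ∣ a)
    (hinv : ∀ P : geomPoints E, (p : ℤ) • P = 0 → σ • σ • P = P)
    (hns : ∀ s : ℤ, s = 1 ∨ s = -1 → ¬ ∀ P : geomPoints E, (p : ℤ) • P = 0 → σ • P = s • P) :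
    (∀ b : geomPoints E, σ • σ • b = b → IsOfFinAddOrder b) ∧
    (∀ b : geomPoints E, σ • σ • b = b → ((ℓ + 1 : ℕ) : ℤ) • b = a • σ • b) ∧
    (∀ s : ℤ, s = 1 ∨ s = -1 → ∃ (g : geomPoints E) (e : ℕ), σ • g = s • g ∧
        addOrderOf g = p ^ e ∧ (p : ℤ) ^ e ∣ ((ℓ + 1 : ℕ) : ℤ) - s * a ∧
        ¬ (p : ℤ) ^ (e + 1) ∣ ((ℓ + 1 : ℕ) : ℤ) - s * a ∧
        ∀ c : geomPoints E, σ • c = s • c → (∃ k : ℕ, ((p : ℤ) ^ k) • c = 0) →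
          ∃ i : ℤ, c = i • g) := by
  refine ⟨fun b _ ↦ isOfFinAddOrder_geomPoints E b, add_one_smul_eq_trace_smul_frob E hσ ha,
    fun s hs ↦ ?_⟩
  obtain ⟨A, hA, hfin, hN⟩ := exists_eigenSubgroup_card E hσ hp2 hpℓ ha hpl hpa hinv hns hs
  haveI := hfin
  haveI := finite_torsion_eigen E (σ := σ) (natCast_ne_zero_of_ne hpℓ) s
  exact exists_eigen_generator E A hA
    (natCard_torsion_eigen E hp2 (natCast_ne_zero_of_ne hpℓ) hinv hns hs).le hN

end Main

end Summit.BirchSwinnertonDyer.Rank1Residual.X11b.KolyvaginH44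

end
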